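import Literature.NumberTheory.Rogawski1990.ArchExplicitTransferFactorTauContinuous  -- part A: `continuousOn_archTau`, `continuous_archWeylRatio`, `continuous_fst_archGroupMatrix`
import Literature.NumberTheory.Rogawski1990.ArchCanonicalTransferFactor           -- ★ `archCanonicalDelta = c(H′) · archExplicitDelta`, `archKappaSignAt`, `archKappaAt_eq_archKappaSignAt_mul`
import Literature.NumberTheory.Rogawski1990.ArchExplicitTransferFactorNondegenerate  -- ★ N2∞: `archKappaAt_ne_zero` (G-regular matching pairs, anisotropic `H′`), `isUnit_eval_archCharpolyTwo_of_isArchGRegular`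
import Mathlib.Topology.Instances.Sign
import HarnessLib

/-!
# Rogawski's explicit ARCHIMEDEAN factor `Δ″_∞ = τ · D_{G∕H,∞} · Π_w κ_w` is CONTINUOUS, and each sign `κ_w` LOCALLY CONSTANT, on the matching pairs
# where the signs do not vanish — in particular on the `G`-regular matching locus (Rogawski (1990) §4.9, §14.6; Langlands–Shelstad (1987) Lemma 4.1.A)

Topic `NumberTheory/Rogawski1990`; namespace `Literature.NumberTheory.Rogawski1990`.  THEOREMS ONLY (no definition, no named fact, no instance, no notation,
no `sorry`; net debt 0).  Cell `pub/hodgecm-mathlib`, F0∕P3a, topic T6 (#88 side): part B of the archimedean companion of ★ `FinExplicitTransferFactorLocallyConstant`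
(node D-G4 of `SIZING-S1prime` §2∕§7 at `v = ∞`, row (κ-arch)): the data facts about ★ `archExplicitDelta` (typ-T6b N1a) ∕ ★ `archCanonicalDelta` (MAIN-b's ray
`Tinf.Δ = c · Δ″_∞`) that the limit argument «`Δ(γ_H δ_t, γ δ_t) → Δ_{G∕H}(γ₀)`» of the singular archimedean κ-identity [Rogawski1990 Prop. 8.2.1 (a), case
`E∕F = ℂ∕ℝ` pp. 118–119; Lemma 14.5.2 (b) proof p. 238] consumes.  Mathlib-only footing; count-neutral for the books.

THE MATHEMATICS.  `L` CM, `H_∞ = U(Φ₂)(L⁺⊗ℝ) × U(Φ₁)(L⁺⊗ℝ)`, `G′_∞ = U(H′)(L⁺⊗ℝ)`, closed subgroups of `GL(L ⊗ ℝ)`; `u = γ₂`, `χ_g`; at a complex place `w`: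
`P_w = χ_{g_w}(γ′_w) = γ′_w² − tr(g_w)γ′_w + det g_w`, `κ_w = sgn Re tr(P_wᴴ · w(H′) · P_w) · η_w(H′)` (★ `archKappaAt = archKappaSignAt · archMajoritySign`).
(§2) `(γ_H, γ′) ↦ P_w` and `Re tr(P_wᴴ w(H′) P_w)` are continuous (★ `continuous_evalC`); `sgn` is locally constant off `0` (Mathlib `continuousAt_sign_of_ne_zero`), so
`κ_w` is LOCALLY CONSTANT near every pair where `κ_w ≠ 0` — no matching hypothesis needed; ★ N2∞ `archKappaAt_ne_zero` supplies `κ_w ≠ 0` on the `G`-regular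
matching pairs for anisotropic `H′` (and for the `G`-singular `(G,H)`-regular RATIONAL pairs over print's `γ₀ ∈ M` it is ★
`archKappaSignAt_rationalArch_eq_one_or_eq_neg_one_of_eval_ne_zero`, (P-γ)).  (§3) HEAD `continuousOn_archExplicitDelta`: with `τ`, `D` continuous (part A ★
`continuousOn_archTau`, ★ `continuous_archWeylRatio`) and `Π_w κ_w` eventually constant, `Δ″_∞ = τ D Πκ` (★ `archExplicitDelta_of_isArchNormPair`) is continuous on
`{ι(γ_H) ↔ γ′ ∧ χ_g(u) unit ∧ ∀ w, κ_w ≠ 0}`; hence (`continuousOn_archExplicitDelta_of_isArchGRegular`) on the `G`-regular matching locus for anisotropic hermitian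
`H′` — Langlands–Shelstad's «transfer factors are smooth on the strongly `G`-regular set» for print's explicit factor — and the same for the ray `Δ‴_∞ = c(H′)·Δ″_∞`.

* §2 `continuous_archGroupMatrix`, `continuous_archEigenlineProjector`, `continuous_re_trace_archEigenlineForm`, **`archKappaSignAt_eventually_eq_of_ne_zero`**,
  **`archKappaAt_eventually_eq_of_ne_zero`**, `prod_archKappaAt_eventually_eq_of_forall_ne_zero`.
* §3 HEAD **`continuousOn_archExplicitDelta`**, `continuousOn_archCanonicalDelta`, **`continuousOn_archExplicitDelta_of_isArchGRegular`**,
  `continuousOn_archCanonicalDelta_of_isArchGRegular`.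

HONEST LABEL: HC_CM is proved only modulo the printed citations (named inputs remaining 2) until rung 0 closes; this file proves none of them — it is the
continuity bookkeeping of print's explicit archimedean factor, one input of the (κ-arch)∕(ST-∞-s) letters of `S1′`, not those letters; Harish-Chandra's
limit formulas (the orbital-integral side) are untouched.

## References
* [Rogawski1990] J. D. Rogawski, *Automorphic Representations of Unitary Groups in Three Variables*, Ann. of Math. Stud. 123 (1990): §4.9 p. 55 (`τ`, `D_{G∕H}`,
  `Δ_{G∕H}`), §14.6 p. 242 (`Δ″_∞`, «`κ(γ, ψ_v(i(γ)))` is equal to `±1`»), Prop. 8.2.1 (a) p. 118 and the case `E∕F = ℂ∕ℝ` pp. 118–119, Lemma 14.5.2 (b) and its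
  proof p. 238 («the method used in the proof of Proposition 8.2.1 gives `Δ_{G∕H}(γ₀)Φ(γ₀, f′_v) = f′^H_v(γ₀)`»).
* [LanglandsShelstad1987] R. P. Langlands, D. Shelstad, *On the definition of transfer factors*, Math. Ann. 278 (1987), §1–§2 (`inv`, `κ`), Lemma 4.1.A.
-/

set_option autoImplicit false

noncomputable section

open NumberField InfinitePlace IsDedekindDomain Matrix Polynomial Filter Topology
open scoped MatrixGroups ComplexConjugate

namespace Literature.NumberTheory.Rogawski1990

open Literature.NumberTheory.Automorphic
open Literature.NumberTheory.GaloisRepresentations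
open Literature.AlgebraicGeometry.ShimuraVarieties (hermForm)

/-! ## §2 Continuity of `P_w`; local constancy of `κ_w` off its zero set -/

section Kappa

variable (L : Type) [Field L] [NumberField L] [IsCMField L] (H' : Matrix (Fin 3) (Fin 3) L) (w : {w : InfinitePlace L // IsComplex w})

/-- `γ′ ↦ γ′` (as a matrix over `L ⊗ ℝ`) is continuous. [cite: Rogawski1990, §14.6 p. 242] -/
theorem continuous_archGroupMatrix :
    Continuous fun b : ↥(UnitaryGroup.arch (↥(maximalRealSubfield L)) L (IsCMField.complexConj L) 3 H') =>
      ((b : GL (Fin 3) (mixedEmbedding.mixedSpace L)) : Matrix (Fin 3) (Fin 3) (mixedEmbedding.mixedSpace L)) :=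
  Units.continuous_val.comp continuous_subtype_val

/-- **`(γ_H, γ′) ↦ P_w = γ′_w² − tr(g_w) γ′_w + det(g_w)` is continuous.** [cite: Rogawski1990, §14.6 p. 242; §4.9 p. 55] -/
theorem continuous_archEigenlineProjector :
    Continuous fun q : (↥(UnitaryGroup.arch (↥(maximalRealSubfield L)) L (IsCMField.complexConj L) 2
          (Matrix.of fun i j : Fin 2 => if i.val + j.val + 1 = 2 then (1 : L) else 0)) ×
        ↥(UnitaryGroup.arch (↥(maximalRealSubfield L)) L (IsCMField.complexConj L) 1
          (Matrix.of fun i j : Fin 1 => if i.val + j.val + 1 = 1 then (1 : L) else 0))) ×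
        ↥(UnitaryGroup.arch (↥(maximalRealSubfield L)) L (IsCMField.complexConj L) 3 H') =>
      archEigenlineProjector L H' q.1 w q.2 := by
  have hφ := UnitaryGroup.continuous_evalC L w
  have hg : Continuous fun q : (↥(UnitaryGroup.arch (↥(maximalRealSubfield L)) L (IsCMField.complexConj L) 2
          (Matrix.of fun i j : Fin 2 => if i.val + j.val + 1 = 2 then (1 : L) else 0)) ×
        ↥(UnitaryGroup.arch (↥(maximalRealSubfield L)) L (IsCMField.complexConj L) 1
          (Matrix.of fun i j : Fin 1 => if i.val + j.val + 1 = 1 then (1 : L) else 0))) ×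
        ↥(UnitaryGroup.arch (↥(maximalRealSubfield L)) L (IsCMField.complexConj L) 3 H') =>
      (((q.1.1 : GL (Fin 2) (mixedEmbedding.mixedSpace L)) : Matrix (Fin 2) (Fin 2) (mixedEmbedding.mixedSpace L)).map (UnitaryGroup.evalC L w)) :=
    ((continuous_fst_archGroupMatrix L).comp continuous_fst).matrix_map hφ
  have hx : Continuous fun q : (↥(UnitaryGroup.arch (↥(maximalRealSubfield L)) L (IsCMField.complexConj L) 2
          (Matrix.of fun i j : Fin 2 => if i.val + j.val + 1 = 2 then (1 : L) else 0)) ×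
        ↥(UnitaryGroup.arch (↥(maximalRealSubfield L)) L (IsCMField.complexConj L) 1
          (Matrix.of fun i j : Fin 1 => if i.val + j.val + 1 = 1 then (1 : L) else 0))) ×
        ↥(UnitaryGroup.arch (↥(maximalRealSubfield L)) L (IsCMField.complexConj L) 3 H') =>
      (((q.2 : GL (Fin 3) (mixedEmbedding.mixedSpace L)) : Matrix (Fin 3) (Fin 3) (mixedEmbedding.mixedSpace L)).map (UnitaryGroup.evalC L w)) :=
    ((continuous_archGroupMatrix L H').comp continuous_snd).matrix_map hφ
  dsimp only [archEigenlineProjector]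
  exact ((hx.mul hx).sub ((hg.matrix_trace).smul hx)).add ((hg.matrix_det).smul continuous_const)

/-- **`(γ_H, γ′) ↦ Re tr(P_wᴴ · w(H′) · P_w)` is continuous.** [cite: Rogawski1990, §14.6 p. 242] -/
theorem continuous_re_trace_archEigenlineForm :
    Continuous fun q : (↥(UnitaryGroup.arch (↥(maximalRealSubfield L)) L (IsCMField.complexConj L) 2
          (Matrix.of fun i j : Fin 2 => if i.val + j.val + 1 = 2 then (1 : L) else 0)) ×
        ↥(UnitaryGroup.arch (↥(maximalRealSubfield L)) L (IsCMField.complexConj L) 1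
          (Matrix.of fun i j : Fin 1 => if i.val + j.val + 1 = 1 then (1 : L) else 0))) ×
        ↥(UnitaryGroup.arch (↥(maximalRealSubfield L)) L (IsCMField.complexConj L) 3 H') =>
      (Matrix.trace ((archEigenlineProjector L H' q.1 w q.2)ᴴ * H'.map w.1.embedding * archEigenlineProjector L H' q.1 w q.2)).re := by
  have hP := continuous_archEigenlineProjector L H' w
  have hPH : Continuous fun q : (↥(UnitaryGroup.arch (↥(maximalRealSubfield L)) L (IsCMField.complexConj L) 2
          (Matrix.of fun i j : Fin 2 => if i.val + j.val + 1 = 2 then (1 : L) else 0)) ×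
        ↥(UnitaryGroup.arch (↥(maximalRealSubfield L)) L (IsCMField.complexConj L) 1
          (Matrix.of fun i j : Fin 1 => if i.val + j.val + 1 = 1 then (1 : L) else 0))) ×
        ↥(UnitaryGroup.arch (↥(maximalRealSubfield L)) L (IsCMField.complexConj L) 3 H') =>
      (archEigenlineProjector L H' q.1 w q.2)ᴴ := hP.matrix_conjTranspose
  exact Complex.continuous_re.comp (((hPH.mul continuous_const).mul hP).matrix_trace)

/-- **`κ‴_w = sgn Re tr(P_wᴴ w(H′) P_w)` IS LOCALLY CONSTANT OFF ITS ZERO SET**: if `κ‴_w(γ_H, γ′) ≠ 0` then `κ‴_w` is constant near `(γ_H, γ′)` (the sign of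
a continuous real function is locally constant where it is non-zero, Mathlib `continuousAt_sign_of_ne_zero`).  No matching hypothesis is needed.
[cite: Rogawski1990, §14.6 p. 242] [cite: LanglandsShelstad1987, Lemma 4.1.A] -/
theorem archKappaSignAt_eventually_eq_of_ne_zero
    {a₀ : ↥(UnitaryGroup.arch (↥(maximalRealSubfield L)) L (IsCMField.complexConj L) 2
          (Matrix.of fun i j : Fin 2 => if i.val + j.val + 1 = 2 then (1 : L) else 0)) ×
        ↥(UnitaryGroup.arch (↥(maximalRealSubfield L)) L (IsCMField.complexConj L) 1
          (Matrix.of fun i j : Fin 1 => if i.val + j.val + 1 = 1 then (1 : L) else 0))}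
    {b₀ : ↥(UnitaryGroup.arch (↥(maximalRealSubfield L)) L (IsCMField.complexConj L) 3 H')} (h : archKappaSignAt L H' a₀ w b₀ ≠ 0) :
    ∀ᶠ q in 𝓝 (a₀, b₀), archKappaSignAt L H' q.1 w q.2 = archKappaSignAt L H' a₀ w b₀ := by
  have hF0 : (Matrix.trace ((archEigenlineProjector L H' a₀ w b₀)ᴴ * H'.map w.1.embedding * archEigenlineProjector L H' a₀ w b₀)).re ≠ 0 := by
    intro h0
    apply h
    unfold archKappaSignAt
    rw [h0, sign_zero, SignType.coe_zero]
  have hcont := (continuous_re_trace_archEigenlineForm L H' w).continuousAt (x := (a₀, b₀))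
  have hsign := ContinuousAt.comp (g := (SignType.sign : ℝ → SignType))
    (f := fun q : (↥(UnitaryGroup.arch (↥(maximalRealSubfield L)) L (IsCMField.complexConj L) 2
          (Matrix.of fun i j : Fin 2 => if i.val + j.val + 1 = 2 then (1 : L) else 0)) ×
        ↥(UnitaryGroup.arch (↥(maximalRealSubfield L)) L (IsCMField.complexConj L) 1
          (Matrix.of fun i j : Fin 1 => if i.val + j.val + 1 = 1 then (1 : L) else 0))) ×
        ↥(UnitaryGroup.arch (↥(maximalRealSubfield L)) L (IsCMField.complexConj L) 3 H') =>
      (Matrix.trace ((archEigenlineProjector L H' q.1 w q.2)ᴴ * H'.map w.1.embedding * archEigenlineProjector L H' q.1 w q.2)).re)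
    (x := (a₀, b₀)) (continuousAt_sign_of_ne_zero hF0) hcont
  have hev := hsign.preimage_mem_nhds ((isOpen_discrete
    ({SignType.sign ((Matrix.trace ((archEigenlineProjector L H' a₀ w b₀)ᴴ * H'.map w.1.embedding *
      archEigenlineProjector L H' a₀ w b₀)).re)} : Set SignType)).mem_nhds rfl)
  filter_upwards [hev] with q hq
  rw [Set.mem_preimage, Function.comp_apply, Set.mem_singleton_iff] at hq
  unfold archKappaSignAt
  rw [hq]

/-- **`κ_w = κ‴_w · η_w(H′)` IS LOCALLY CONSTANT OFF ITS ZERO SET.** [cite: Rogawski1990, §14.6 p. 242] [cite: LanglandsShelstad1987, Lemma 4.1.A] -/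
theorem archKappaAt_eventually_eq_of_ne_zero
    {a₀ : ↥(UnitaryGroup.arch (↥(maximalRealSubfield L)) L (IsCMField.complexConj L) 2
          (Matrix.of fun i j : Fin 2 => if i.val + j.val + 1 = 2 then (1 : L) else 0)) ×
        ↥(UnitaryGroup.arch (↥(maximalRealSubfield L)) L (IsCMField.complexConj L) 1
          (Matrix.of fun i j : Fin 1 => if i.val + j.val + 1 = 1 then (1 : L) else 0))}
    {b₀ : ↥(UnitaryGroup.arch (↥(maximalRealSubfield L)) L (IsCMField.complexConj L) 3 H')} (h : archKappaAt L H' a₀ w b₀ ≠ 0) :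
    ∀ᶠ q in 𝓝 (a₀, b₀), archKappaAt L H' q.1 w q.2 = archKappaAt L H' a₀ w b₀ := by
  have hs : archKappaSignAt L H' a₀ w b₀ ≠ 0 := by
    intro h0
    apply h
    rw [archKappaAt_eq_archKappaSignAt_mul, h0, zero_mul]
  filter_upwards [archKappaSignAt_eventually_eq_of_ne_zero L H' w hs] with q hq
  rw [archKappaAt_eq_archKappaSignAt_mul, archKappaAt_eq_archKappaSignAt_mul, hq]

open scoped Classical in
/-- **`Π_w κ_w` is locally constant where no `κ_w` vanishes.** [cite: Rogawski1990, §14.6 p. 242] -/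
theorem prod_archKappaAt_eventually_eq_of_forall_ne_zero
    {a₀ : ↥(UnitaryGroup.arch (↥(maximalRealSubfield L)) L (IsCMField.complexConj L) 2
          (Matrix.of fun i j : Fin 2 => if i.val + j.val + 1 = 2 then (1 : L) else 0)) ×
        ↥(UnitaryGroup.arch (↥(maximalRealSubfield L)) L (IsCMField.complexConj L) 1
          (Matrix.of fun i j : Fin 1 => if i.val + j.val + 1 = 1 then (1 : L) else 0))}
    {b₀ : ↥(UnitaryGroup.arch (↥(maximalRealSubfield L)) L (IsCMField.complexConj L) 3 H')}
    (h : ∀ w' : {w : InfinitePlace L // IsComplex w}, archKappaAt L H' a₀ w' b₀ ≠ 0) :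
    ∀ᶠ q in 𝓝 (a₀, b₀),
      (∏ w' : {w : InfinitePlace L // IsComplex w}, archKappaAt L H' q.1 w' q.2) =
        ∏ w' : {w : InfinitePlace L // IsComplex w}, archKappaAt L H' a₀ w' b₀ := by
  have hall := eventually_all.2 fun w' => archKappaAt_eventually_eq_of_ne_zero L H' w' (h w')
  filter_upwards [hall] with q hq
  exact Finset.prod_congr rfl fun w' _ => hq w'

end Kappa

/-! ## §3 HEAD: `Δ″_∞` (and the ray `Δ‴_∞ = c(H′)·Δ″_∞`) is continuous on the matching pairs with non-vanishing signs -/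

section Head

variable (L : Type) [Field L] [NumberField L] [IsCMField L] (H' : Matrix (Fin 3) (Fin 3) L)

open scoped Classical in
/-- **ROGAWSKI'S EXPLICIT ARCHIMEDEAN FACTOR `Δ″_∞ = τ · D_{G∕H,∞} · Π_w κ_w` IS CONTINUOUS ON THE MATCHING PAIRS WITH `χ_g(u)` A UNIT AND NO VANISHING SIGN**
— every `H′`, every Hecke character `μ`: on `S = {(γ_H, γ′) : ι(γ_H) ↔ γ′ ∧ χ_g(u) ∈ (L⊗ℝ)^× ∧ ∀ w, κ_w(γ_H, γ′) ≠ 0}` the map `(γ_H, γ′) ↦ Δ″_∞(γ_H, γ′)` (★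
`archExplicitDelta`) is continuous (`= τ D Πκ` there, ★ `archExplicitDelta_of_isArchNormPair`; `τ`, `D` continuous §1, each `κ_w` locally constant §2).  `S`
contains the `G`-regular matching pairs for anisotropic hermitian `H′` (★ `archKappaAt_ne_zero`) and the `(G,H)`-regular RATIONAL pairs over print's singular
`γ₀ ∈ M` (★ `archKappaSignAt_rationalArch_eq_one_or_eq_neg_one_of_eval_ne_zero`). [cite: Rogawski1990, §14.6 p. 242; §4.9 p. 55; Prop. 8.2.1 (a) p. 118; Lemma 14.5.2 (b) proof p. 238] [cite: LanglandsShelstad1987, Lemma 4.1.A] -/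
theorem continuousOn_archExplicitDelta (μ : HeckeCharacter L) :
    ContinuousOn
      (fun q : (↥(UnitaryGroup.arch (↥(maximalRealSubfield L)) L (IsCMField.complexConj L) 2
          (Matrix.of fun i j : Fin 2 => if i.val + j.val + 1 = 2 then (1 : L) else 0)) ×
        ↥(UnitaryGroup.arch (↥(maximalRealSubfield L)) L (IsCMField.complexConj L) 1
          (Matrix.of fun i j : Fin 1 => if i.val + j.val + 1 = 1 then (1 : L) else 0))) ×
        ↥(UnitaryGroup.arch (↥(maximalRealSubfield L)) L (IsCMField.complexConj L) 3 H') => archExplicitDelta L H' q.1 μ q.2)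
      {q | IsArchNormPair L H' q.1 q.2 ∧ IsUnit ((archCharpolyTwo L q.1).eval (archGammaTwo L q.1)) ∧
        ∀ w : {w : InfinitePlace L // IsComplex w}, archKappaAt L H' q.1 w q.2 ≠ 0} := by
  rintro ⟨a₀, b₀⟩ ⟨h₀, hu₀, hκ₀⟩
  -- `τ · D` is continuous at `a₀` within anything
  have hτ : ContinuousWithinAt (fun q : (↥(UnitaryGroup.arch (↥(maximalRealSubfield L)) L (IsCMField.complexConj L) 2
          (Matrix.of fun i j : Fin 2 => if i.val + j.val + 1 = 2 then (1 : L) else 0)) ×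
        ↥(UnitaryGroup.arch (↥(maximalRealSubfield L)) L (IsCMField.complexConj L) 1
          (Matrix.of fun i j : Fin 1 => if i.val + j.val + 1 = 1 then (1 : L) else 0))) ×
        ↥(UnitaryGroup.arch (↥(maximalRealSubfield L)) L (IsCMField.complexConj L) 3 H') => archTau L q.1 μ)
      {q | IsArchNormPair L H' q.1 q.2 ∧ IsUnit ((archCharpolyTwo L q.1).eval (archGammaTwo L q.1)) ∧
        ∀ w : {w : InfinitePlace L // IsComplex w}, archKappaAt L H' q.1 w q.2 ≠ 0} (a₀, b₀) :=
    ((continuousOn_archTau L μ).comp continuous_fst.continuousOn (fun q hq => hq.2.1)) _ ⟨h₀, hu₀, hκ₀⟩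
  have hD : ContinuousWithinAt (fun q : (↥(UnitaryGroup.arch (↥(maximalRealSubfield L)) L (IsCMField.complexConj L) 2
          (Matrix.of fun i j : Fin 2 => if i.val + j.val + 1 = 2 then (1 : L) else 0)) ×
        ↥(UnitaryGroup.arch (↥(maximalRealSubfield L)) L (IsCMField.complexConj L) 1
          (Matrix.of fun i j : Fin 1 => if i.val + j.val + 1 = 1 then (1 : L) else 0))) ×
        ↥(UnitaryGroup.arch (↥(maximalRealSubfield L)) L (IsCMField.complexConj L) 3 H') => (archWeylRatio L q.1 : ℂ))
      {q | IsArchNormPair L H' q.1 q.2 ∧ IsUnit ((archCharpolyTwo L q.1).eval (archGammaTwo L q.1)) ∧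
        ∀ w : {w : InfinitePlace L // IsComplex w}, archKappaAt L H' q.1 w q.2 ≠ 0} (a₀, b₀) :=
    (Complex.continuous_ofReal.comp ((continuous_archWeylRatio L).comp continuous_fst)).continuousWithinAt
  -- `Π_w κ_w` is eventually constant near `(a₀, b₀)`
  have hκ : ContinuousWithinAt (fun q : (↥(UnitaryGroup.arch (↥(maximalRealSubfield L)) L (IsCMField.complexConj L) 2
          (Matrix.of fun i j : Fin 2 => if i.val + j.val + 1 = 2 then (1 : L) else 0)) ×
        ↥(UnitaryGroup.arch (↥(maximalRealSubfield L)) L (IsCMField.complexConj L) 1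
          (Matrix.of fun i j : Fin 1 => if i.val + j.val + 1 = 1 then (1 : L) else 0))) ×
        ↥(UnitaryGroup.arch (↥(maximalRealSubfield L)) L (IsCMField.complexConj L) 3 H') =>
        ((∏ w : {w : InfinitePlace L // IsComplex w}, archKappaAt L H' q.1 w q.2 : ℤ) : ℂ))
      {q | IsArchNormPair L H' q.1 q.2 ∧ IsUnit ((archCharpolyTwo L q.1).eval (archGammaTwo L q.1)) ∧
        ∀ w : {w : InfinitePlace L // IsComplex w}, archKappaAt L H' q.1 w q.2 ≠ 0} (a₀, b₀) := by
    refine (continuousWithinAt_const (b := ((∏ w : {w : InfinitePlace L // IsComplex w}, archKappaAt L H' a₀ w b₀ : ℤ) : ℂ))).congr_of_eventuallyEq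
      ?_ rfl
    exact mem_nhdsWithin_of_mem_nhds ((prod_archKappaAt_eventually_eq_of_forall_ne_zero L H' hκ₀).mono fun q hq => by
      simp only [hq])
  refine ((hτ.mul hD).mul hκ).congr_of_eventuallyEq ?_ (archExplicitDelta_of_isArchNormPair L H' a₀ μ h₀)
  filter_upwards [self_mem_nhdsWithin] with q hq
  exact archExplicitDelta_of_isArchNormPair L H' q.1 μ hq.1

open scoped Classical in
/-- **The ray `Δ‴_∞ = c(H′) · Δ″_∞` is continuous on the same locus** (★ `archCanonicalDelta_eq_mul`). [cite: Rogawski1990, §14.6 p. 242] -/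
theorem continuousOn_archCanonicalDelta (μ : HeckeCharacter L) :
    ContinuousOn
      (fun q : (↥(UnitaryGroup.arch (↥(maximalRealSubfield L)) L (IsCMField.complexConj L) 2
          (Matrix.of fun i j : Fin 2 => if i.val + j.val + 1 = 2 then (1 : L) else 0)) ×
        ↥(UnitaryGroup.arch (↥(maximalRealSubfield L)) L (IsCMField.complexConj L) 1
          (Matrix.of fun i j : Fin 1 => if i.val + j.val + 1 = 1 then (1 : L) else 0))) ×
        ↥(UnitaryGroup.arch (↥(maximalRealSubfield L)) L (IsCMField.complexConj L) 3 H') => archCanonicalDelta L H' q.1 μ q.2)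
      {q | IsArchNormPair L H' q.1 q.2 ∧ IsUnit ((archCharpolyTwo L q.1).eval (archGammaTwo L q.1)) ∧
        ∀ w : {w : InfinitePlace L // IsComplex w}, archKappaAt L H' q.1 w q.2 ≠ 0} := by
  simp_rw [archCanonicalDelta_eq_mul]
  exact continuousOn_const.mul (continuousOn_archExplicitDelta L H' μ)

open scoped Classical in
/-- **`Δ″_∞` IS CONTINUOUS ON THE `G`-REGULAR MATCHING LOCUS** for `c`-hermitian anisotropic `H′` (there `χ_g(u)` is a unit, ★
`isUnit_eval_archCharpolyTwo_of_isArchGRegular`, and no `κ_w` vanishes, ★ N2∞ `archKappaAt_ne_zero`) — the explicit-factor form of «transfer factors are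
smooth on the strongly `G`-regular set». [cite: LanglandsShelstad1987, Lemma 4.1.A] [cite: Rogawski1990, §14.6 p. 242; §4.9 p. 55] -/
theorem continuousOn_archExplicitDelta_of_isArchGRegular (hherm : (H'.map (cmConjRingHom L)).transpose = H')
    (hanis : ∀ x : Fin 3 → L, hermForm (cmConjRingHom L) H' x x = 0 → x = 0) (μ : HeckeCharacter L) :
    ContinuousOn
      (fun q : (↥(UnitaryGroup.arch (↥(maximalRealSubfield L)) L (IsCMField.complexConj L) 2
          (Matrix.of fun i j : Fin 2 => if i.val + j.val + 1 = 2 then (1 : L) else 0)) ×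
        ↥(UnitaryGroup.arch (↥(maximalRealSubfield L)) L (IsCMField.complexConj L) 1
          (Matrix.of fun i j : Fin 1 => if i.val + j.val + 1 = 1 then (1 : L) else 0))) ×
        ↥(UnitaryGroup.arch (↥(maximalRealSubfield L)) L (IsCMField.complexConj L) 3 H') => archExplicitDelta L H' q.1 μ q.2)
      {q | IsArchNormPair L H' q.1 q.2 ∧ IsArchGRegular L q.1} :=
  (continuousOn_archExplicitDelta L H' μ).mono fun q hq =>
    ⟨hq.1, isUnit_eval_archCharpolyTwo_of_isArchGRegular L q.1 hq.2, fun w => archKappaAt_ne_zero L H' q.1 q.2 w hherm hanis hq.1 hq.2⟩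

open scoped Classical in
/-- **The ray `Δ‴_∞` is continuous on the `G`-regular matching locus** (anisotropic hermitian `H′`). [cite: LanglandsShelstad1987, Lemma 4.1.A] [cite: Rogawski1990, §14.6 p. 242] -/
theorem continuousOn_archCanonicalDelta_of_isArchGRegular (hherm : (H'.map (cmConjRingHom L)).transpose = H')
    (hanis : ∀ x : Fin 3 → L, hermForm (cmConjRingHom L) H' x x = 0 → x = 0) (μ : HeckeCharacter L) :
    ContinuousOn
      (fun q : (↥(UnitaryGroup.arch (↥(maximalRealSubfield L)) L (IsCMField.complexConj L) 2
          (Matrix.of fun i j : Fin 2 => if i.val + j.val + 1 = 2 then (1 : L) else 0)) ×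
        ↥(UnitaryGroup.arch (↥(maximalRealSubfield L)) L (IsCMField.complexConj L) 1
          (Matrix.of fun i j : Fin 1 => if i.val + j.val + 1 = 1 then (1 : L) else 0))) ×
        ↥(UnitaryGroup.arch (↥(maximalRealSubfield L)) L (IsCMField.complexConj L) 3 H') => archCanonicalDelta L H' q.1 μ q.2)
      {q | IsArchNormPair L H' q.1 q.2 ∧ IsArchGRegular L q.1} :=
  (continuousOn_archCanonicalDelta L H' μ).mono fun q hq =>
    ⟨hq.1, isUnit_eval_archCharpolyTwo_of_isArchGRegular L q.1 hq.2, fun w => archKappaAt_ne_zero L H' q.1 q.2 w hherm hanis hq.1 hq.2⟩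

end Head

end Literature.NumberTheory.Rogawski1990

end
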